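import Literature.Probability.Percolation.SlabMSFNoNewCircuit
import HarnessLib

/-!
# RSW3 lane (P1, gen 34): NTW 2017 §4 — THE SIZE OF THE PLUS CYLINDER `B̄₁^#(z′)` AND OF THE MODIFIED PAIR SET
# `S(ω′)` (the exponent `s` of Lemma 4.2 is uniform)

builds on p205010 (kernel theorem, internal audit signed; external expert review pending) — NOT used in this file.

Cell `prim-rsw3`, prover seat `prim-rsw3-p1` (gen 34), build-out blueprint `prim-rsw3-lead/gen44/BUILDOUT-PLAN.md` §4
(`ncard_plusEdges_le`: "`s` := a uniform bound on `(surgS Γ y).toFinset.card`") of the sequel NTW 2017 Thm 2.4.  Support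
file (`--supports stmt-CriticalPhenomena-4575`); no definitions, no named facts, no sorries.

Newman–Tassion–Wu (arXiv:1512.09107, p. 21): «we obtain `P[Φ_i(𝓐_i)] ≥ (2/(p_c ∧ (1−p₁)))^{−s} P[𝓐_i]`, with `s` equal
to the number of edges in `B̄₁^#`» — the only property of `s` used is that it does not depend on the piece (nor on the
scale).  With `S(ω′) ⊆` the slab edges inside the cylinder `B̄₁^#(z′)` (`NTW17.surgS_subset_plusEdges`) a crude uniform
bound suffices:

* `ncard_plusCyl_le` — `|B̄₁^#(y)| ≤ 9 (k+1)` (the cylinder lies over the `3 × 3` box `y + B₁`, with `k+1` heights);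
* **`ncard_plusEdges_le`** — the number of slab edges inside `B̄₁^#(y)` is at most `(9 (k+1))²`;
* `ncard_surgS_le`, **`card_toFinset_surgS_le`** — hence `|S| ≤ (9 (k+1))²` for every `Γ`, `y`, in the `Finset` form
  `h.toFinset.card` for ANY finiteness proof `h` (the form `surgFin` of the surgery files).

References: C. M. Newman, V. Tassion, W. Wu, *Critical percolation and the minimal spanning tree in slabs*, CPAM 70
(2017), arXiv:1512.09107, §4.1 (proof of Lemma 4.1, p. 21: "with s equal to the number of edges in B̄₁^#")
[NewmanTassionWu2017].
-/

noncomputable section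

namespace Summit.CriticalPhenomena.PercolationContinuityZ3.Theorems.Crossing

open Literature.Probability.Percolation Literature.Probability.Percolation.NTW17

variable {k : ℕ}

/-- **`|B̄₁^#(y)| ≤ 9 (k+1)`**: the plus cylinder injects, by `x ↦ (x₀, planar x)`, into `{0,…,k} × (y + B₁)`.
[cite: NewmanTassionWu2017, §4.1 (B̄₁^#(z′), the cylinder generated by the five-point set)] -/
theorem ncard_plusCyl_le (y : ℤ × ℤ) : (plusCyl k y).ncard ≤ 9 * (k + 1) := by
  classical
  -- the target finite set
  set T : Finset (ℕ × (ℤ × ℤ)) :=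
    Finset.range (k + 1) ×ˢ (Finset.Icc (y.1 - 1) (y.1 + 1) ×ˢ Finset.Icc (y.2 - 1) (y.2 + 1)) with hT
  have hTcard : T.card = 9 * (k + 1) := by
    rw [hT, Finset.card_product, Finset.card_product, Finset.card_range, Int.card_Icc, Int.card_Icc]
    have h1 : y.1 + 1 + 1 - (y.1 - 1) = 3 := by ring
    have h2 : y.2 + 1 + 1 - (y.2 - 1) = 3 := by ring
    rw [h1, h2]
    show (k + 1) * (3 * 3) = 9 * (k + 1)
    ring
  -- the injection
  let f : slab 3 k → ℕ × (ℤ × ℤ) := fun x => ((x.1 0).toNat, planar k x)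
  have hf : ∀ x ∈ plusCyl k y, f x ∈ (T : Set (ℕ × (ℤ × ℤ))) := by
    intro x hx
    have hx' : planar k x ∈ sqBox y 1 := plusCols_subset_sqBox y hx
    have h0 := x.2.1
    have h1 := x.2.2
    simp only [sqBox, Set.mem_setOf_eq, abs_le, Nat.cast_one] at hx'
    simp only [hT, Finset.coe_product, Finset.coe_range, Finset.coe_Icc, Set.mem_prod, Set.mem_Iio,
      Set.mem_Icc, f]
    refine ⟨?_, ⟨?_, ?_⟩, ?_, ?_⟩ <;> omega
  have hinj : Set.InjOn f (plusCyl k y) := by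
    intro x hx x' hx' h
    simp only [f, Prod.mk.injEq, planar] at h
    obtain ⟨h0, h1, h2⟩ := h
    have hx0 := x.2.1
    have hx0' := x'.2.1
    apply Subtype.ext
    funext i
    fin_cases i
    · show x.1 0 = x'.1 0
      omega
    · exact h1
    · exact h2
  calc (plusCyl k y).ncard ≤ (T : Set (ℕ × (ℤ × ℤ))).ncard :=
        Set.ncard_le_ncard_of_injOn f hf hinj (Finset.finite_toSet T)
    _ = 9 * (k + 1) := by rw [Set.ncard_coe_finset, hTcard]

/-- **The number of slab edges inside `B̄₁^#(y)` is at most `(9 (k+1))²`** (a uniform bound for the exponent `s` of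
Lemma 4.2). [cite: NewmanTassionWu2017, §4.1 (proof of Lemma 4.1, p. 21: "with s equal to the number of edges in B̄₁^#")] -/
theorem ncard_plusEdges_le (y : ℤ × ℤ) : (plusEdges k y).ncard ≤ (9 * (k + 1)) ^ 2 := by
  have hsub : plusEdges k y ⊆ (fun q : slab 3 k × slab 3 k => s(q.1, q.2)) '' (plusCyl k y ×ˢ plusCyl k y) := by
    intro e he
    induction e using Sym2.ind with
    | h a b => exact ⟨(a, b), ⟨he.2 a (Sym2.mem_mk_left a b), he.2 b (Sym2.mem_mk_right a b)⟩, rfl⟩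
  have hfin : (plusCyl k y ×ˢ plusCyl k y).Finite := (plusCyl_finite (k := k) y).prod (plusCyl_finite (k := k) y)
  calc (plusEdges k y).ncard
      ≤ ((fun q : slab 3 k × slab 3 k => s(q.1, q.2)) '' (plusCyl k y ×ˢ plusCyl k y)).ncard :=
        Set.ncard_le_ncard hsub (hfin.image _)
    _ ≤ (plusCyl k y ×ˢ plusCyl k y).ncard := Set.ncard_image_le hfin
    _ = (plusCyl k y).ncard * (plusCyl k y).ncard := Set.ncard_prod
    _ ≤ (9 * (k + 1)) * (9 * (k + 1)) := Nat.mul_le_mul (ncard_plusCyl_le y) (ncard_plusCyl_le y)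
    _ = (9 * (k + 1)) ^ 2 := by ring

/-- `|S| ≤ (9 (k+1))²` for the modified pair set of the surgery, every `Γ`, `y`.
[cite: NewmanTassionWu2017, §4.1 ("Taking S(ω′) = B̄₁^#(z′) ∖ Γ_min(ω′)")] -/
theorem ncard_surgS_le (Γ : List (slab 3 k)) (y : ℤ × ℤ) : (surgS k Γ y).ncard ≤ (9 * (k + 1)) ^ 2 :=
  (Set.ncard_le_ncard (surgS_subset_plusEdges Γ y) (plusEdges_finite y)).trans (ncard_plusEdges_le y)

/-- **`Finset` form**: `h.toFinset.card ≤ (9 (k+1))²` for ANY finiteness proof `h` of `S` (the uniform exponent consumed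
by `NTW17.labelMeasure_real_le_of_affineRelabel`). [cite: NewmanTassionWu2017, §4.1 (proof of Lemma 4.1, p. 21)] -/
theorem card_toFinset_surgS_le (Γ : List (slab 3 k)) (y : ℤ × ℤ) (h : (surgS k Γ y).Finite) :
    h.toFinset.card ≤ (9 * (k + 1)) ^ 2 := by
  rw [← Set.ncard_eq_toFinset_card (surgS k Γ y) h]
  exact ncard_surgS_le Γ y

/-- The same for the plus edges themselves. [cite: NewmanTassionWu2017, §4.1 (proof of Lemma 4.1, p. 21)] -/
theorem card_toFinset_plusEdges_le (y : ℤ × ℤ) (h : (plusEdges k y).Finite) :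
    h.toFinset.card ≤ (9 * (k + 1)) ^ 2 := by
  rw [← Set.ncard_eq_toFinset_card (plusEdges k y) h]
  exact ncard_plusEdges_le y

end Summit.CriticalPhenomena.PercolationContinuityZ3.Theorems.Crossing
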